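import Literature.NumberTheory.GaloisCohomology.Howard2004.DVRSettingPiRefinementSelmer
import Literature.NumberTheory.GaloisCohomology.Howard2004.DVRSettingPiRefinementRings
import HarnessLib

/-!
# Howard 2004, Remark 1.3.1: H.3 — «the local condition is cartesian on `Quot(T)`» — descends along a
# quotient `T ↠ T/IT` with change of coefficient ring; H.3 for the π-adic refinement of a `DVRSetting`

Topic `NumberTheory/GaloisCohomology/Howard2004`. THEOREMS ONLY: no definition, no named fact, no instance, no
notation, no `sorry`. Cell
`pub/bsd-print-x9`, print leaf G87 `Literature.NumberTheory.GaloisCohomology.Howard2004.thm161_dvrKolyvaginBound`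
(Howard Thm. 1.6.1); seat `bsd-line-x10b-p1` LEAD g12, brick «R3b» of the π-adic REFINEMENT programme (x10b-p1-w2
g16's `DVRSetting.piRefinementDatum` / `refinedTower` / `refinedCond` / `refinedTriple` / `QuotRing` / `toQuotRing`).

SOURCE. B. Howard, *The Heegner point Kolyvagin system*, Compositio Math. **140** (2004) = arXiv:1202.6340, §1.3:
H.3 «For every `v ∈ Σ(F)` the local condition `F` at `v` is cartesian on the category `Quot(T)`» (p. 7 L65–67),
typed VERBATIM as `IsCartesianOnQuotAt ρ R v L` (all presentations `T ↠ T/IT` by ideals of `R`, all injective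
`Quot(T)`-morphisms `f ∘ π_I = r · π_J`); Remark 1.3.1 «It is easily seen that hypotheses H.0–H.5 are stable under
base change in the obvious sense» (p. 7 L125–127); Def. 1.1.2–1.1.3 (p. 5 L88–99).

THE ARGUMENT. Let `ψ : A ↠ Ā` be a surjective ring map and `π̄ : T ↠ T̄` additive, `Γ_K`-equivariant, surjective,
`ψ`-semilinear with `ker π̄ = (ker ψ)·T` (so `T̄ = T ⊗_A Ā`; for the refinement: `A = R_k`, `Ā = R/π^j`,
`T̄ = T^{(k)}/π^j`). Given an `Ā`-presentation `πI : T̄ ↠ T̄/Ī` and an injective `Quot(T̄)`-morphism `f` with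
scalar `r̄ = ψ(r)`, read the carriers over `A` through `ψ` (`Module.compHom`, local to the proof): `πI ∘ π̄` is an
`A`-presentation of `T/(ψ⁻¹Ī)T` (§1: `Ī·T̄ = π̄((ψ⁻¹Ī)·T)`, hence `ker(πI ∘ π̄) = (ψ⁻¹Ī)·T` using `ker ψ ⊆ ψ⁻¹Ī`),
`f` is an `A`-linear `Quot(T)`-morphism with scalar `r` (`r·ψ⁻¹Ī ⊂ ψ⁻¹J̄`), and H.3 for `(T, L)` over `A` gives the
cartesian identity for `(πI ∘ π̄, πJ ∘ π̄, f)`; finally propagating `L` along `πI ∘ π̄` is propagating `π̄_* L` along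
`πI` (`IsQuotientBy.localCohomologyMap_one_eq_comp_apply`). No principal-Artinian structure, freeness or counting.

WHAT IS PROVED.
* §1 `mem_smul_top_iff_exists_of_ringChange` (`Ī·T̄ = π̄((ψ⁻¹Ī)·T)`), `comp_eq_zero_iff_of_ringChange`
  (`ker(πI ∘ π̄) = (ψ⁻¹Ī)·T`).
* §2 **`isCartesianOnQuotAt_map_of_ringChange : IsCartesianOnQuotAt ρ A v L →
  IsCartesianOnQuotAt ρ̄ Ā v (L.map H¹_v(π̄))`**.
* §3 (the refinement; `D := S.piRefinementDatum hy`, `k := S.host hy j`; the `R/π^j`-module structure is Mathlib's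
  `Module (R ⧸ I) (M ⧸ I • ⊤)` on the LITERAL carrier `N k ⧸ Ideal.span {S.π ^ j} • ⊤` of `modIdeal (S.T.ρ k) _ (π^j)`,
  which is `D.levelRep j` / `D.Level j` by `rfl` — the currency instance search accepts, w8 g10 / w2 g16 FINDING
  2026-08-29) `le_e_of_host_le`, `proj_self_eq_mkQ` (`proj = mk` at the host), **`mkQ_smul_levelRing`**
  (`mk (a·y) = toQuotRing(a)·mk y`), `mkQ_eq_zero_iff_mem_ker_smul` (`mk y = 0 ↔ y ∈ (ker toQuotRing)·T^{(k)}`),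
  **`isCartesianOnQuotAt_map_mkQ`** (H.3 on `T^{(k)}/π^j` for `F_k` pushed along `mk`, ANY `k` with `j ≤ e_k`), and
  **`h3_refinedTriple S hy j : H3 (modIdeal (S.T.ρ k) (S.T.hlin k) (Ideal.span {S.π ^ j})) (S.QuotRing j)
  (S.refinedTriple hy j)`** (`k = host j`) — the clause `SatisfiesH.h3` of the refined setting at EVERY exponent `j`.

HONEST FRAMING. Functoriality bookkeeping on top of Howard's Def. 1.1.2–1.1.3 / H.3; the companion H.4 clause is
`SelfOrthogonalBaseChangeProofs`. `thm161_dvrKolyvaginBound` is NOT proved; no summit statement is proved; the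
Birch–Swinnerton-Dyer conjecture is not proved by any of this.
References: [Howard2004HeegnerKolyvagin] §1.3 H.3, Remark 1.3.1, Def. 1.1.2–1.1.3, §1.6; [SerreGaloisCohomology1997]
I §2.2 (functoriality of `H¹`).
-/

set_option autoImplicit false

noncomputable section

open Function NumberField IsDedekindDomain Field
open scoped NumberField

namespace Literature.NumberTheory.GaloisCohomology.Howard2004

open Literature.NumberTheory.GaloisRepresentations
open Literature.NumberTheory.GaloisRepresentations.DiscreteGaloisModule

/-! ## §1 The ideal bookkeeping of a surjective ring change -/

section Generic

variable {K : Type} [Field K] [NumberField K]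
  {A : Type} [CommRing A] {Abar : Type} [CommRing Abar]
  {M : Type} [AddCommGroup M] [TopologicalSpace M] [DiscreteTopology M] [Module A M]
  {Nbar : Type} [AddCommGroup Nbar] [TopologicalSpace Nbar] [DiscreteTopology Nbar] [Module Abar Nbar]

omit [TopologicalSpace M] [DiscreteTopology M] [TopologicalSpace Nbar] [DiscreteTopology Nbar] in
/-- **`Ī·(T/IT) = π̄(ψ⁻¹Ī · T)`** for a surjective ring change `ψ : A → Ā` and a `ψ`-semilinear surjection
`π̄ : T ↠ T/IT`. [cite: Howard2004HeegnerKolyvagin, Def. 1.1.3 and Remark 1.3.1 (arXiv p. 5 L93–99, p. 7 L125–127)] -/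
theorem mem_smul_top_iff_exists_of_ringChange (ψ : A →+* Abar) (hψ : Surjective ψ) (πbar : M →+ Nbar)
    (hπs : Surjective πbar) (hπl : ∀ (a : A) (m : M), πbar (a • m) = ψ a • πbar m) (Ibar : Ideal Abar)
    (n : Nbar) :
    n ∈ (Ibar • (⊤ : Submodule Abar Nbar) : Submodule Abar Nbar) ↔
      ∃ m ∈ (Ibar.comap ψ • (⊤ : Submodule A M) : Submodule A M), πbar m = n := by
  constructor
  · intro hn
    refine Submodule.smul_induction_on hn (fun a ha x _ => ?_) ?_
    · obtain ⟨b, rfl⟩ := hψ a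
      obtain ⟨m, rfl⟩ := hπs x
      refine ⟨b • m, Submodule.smul_mem_smul (show b ∈ Ibar.comap ψ from ha) Submodule.mem_top, ?_⟩
      rw [hπl]
    · rintro x y ⟨mx, hmx, rfl⟩ ⟨my, hmy, rfl⟩
      exact ⟨mx + my, Submodule.add_mem _ hmx hmy, map_add _ _ _⟩
  · rintro ⟨m, hm, rfl⟩
    refine Submodule.smul_induction_on hm (fun a ha x _ => ?_) (fun x y hx hy => ?_)
    · rw [hπl]
      exact Submodule.smul_mem_smul ha Submodule.mem_top
    · rw [map_add]
      exact Submodule.add_mem _ hx hy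

omit [TopologicalSpace M] [DiscreteTopology M] [TopologicalSpace Nbar] [DiscreteTopology Nbar] in
/-- The kernel of `πI ∘ π̄` for an `Ā`-presentation `πI : T/IT ↠ (T/IT)/Ī` is `ψ⁻¹Ī · T`, when `ker π̄ = (ker ψ)·T`.
[cite: Howard2004HeegnerKolyvagin, Def. 1.1.3 and Remark 1.3.1 (arXiv p. 5 L93–99, p. 7 L125–127)] -/
theorem comp_eq_zero_iff_of_ringChange (ψ : A →+* Abar) (hψ : Surjective ψ) (πbar : M →+ Nbar)
    (hπs : Surjective πbar) (hπl : ∀ (a : A) (m : M), πbar (a • m) = ψ a • πbar m)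
    (hπk : ∀ m : M, πbar m = 0 ↔ m ∈ (RingHom.ker ψ • (⊤ : Submodule A M) : Submodule A M))
    {N : Type} [AddCommGroup N] [Module Abar N] (Ibar : Ideal Abar) (πI : Nbar →ₗ[Abar] N)
    (hker : LinearMap.ker πI = Ibar • (⊤ : Submodule Abar Nbar)) (m : M) :
    πI (πbar m) = 0 ↔ m ∈ (Ibar.comap ψ • (⊤ : Submodule A M) : Submodule A M) := by
  rw [← LinearMap.mem_ker, hker, mem_smul_top_iff_exists_of_ringChange ψ hψ πbar hπs hπl]
  constructor
  · rintro ⟨m', hm', hmm'⟩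
    have hdiff : m - m' ∈ (RingHom.ker ψ • (⊤ : Submodule A M) : Submodule A M) := by
      rw [← hπk, map_sub, hmm', sub_self]
    have hle : (RingHom.ker ψ • (⊤ : Submodule A M) : Submodule A M) ≤ Ibar.comap ψ • ⊤ :=
      Submodule.smul_mono_left fun x hx => by
        rw [Ideal.mem_comap, RingHom.mem_ker.mp hx]; exact Ibar.zero_mem
    simpa using Submodule.add_mem _ (hle hdiff) hm'
  · intro hm
    exact ⟨m, hm, rfl⟩

end Generic

/-! ## §2 H.3 descends along `π̄` -/

section Cartesian

variable {K : Type} [Field K] [NumberField K]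
  {A : Type} [CommRing A] {Abar : Type} [CommRing Abar]
  {M : Type} [AddCommGroup M] [TopologicalSpace M] [DiscreteTopology M] [Module A M]
  {Nbar : Type} [AddCommGroup Nbar] [TopologicalSpace Nbar] [DiscreteTopology Nbar] [Module Abar Nbar]

/-- **H.3 base change (Howard, Remark 1.3.1 «hypotheses H.0–H.5 are stable under base change»), the cartesian
clause.** Let `ψ : A ↠ Ā` be a surjective ring change and `π̄ : T ↠ T/IT` a presentation of discrete `Γ_K`-modules
which is additive, `Γ_K`-equivariant, surjective, `ψ`-SEMILINEAR (`π̄(a·m) = ψ(a)·π̄(m)`) with kernel `(ker ψ)·T`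
(`T/IT = T ⊗_A Ā`). If a local condition `L ≤ H¹(K_v, T)` is cartesian on `Quot(T)` (over `A`) at `v`, then its
propagation `π̄_* L ≤ H¹(K_v, T/IT)` is cartesian on `Quot(T/IT)` (over `Ā`) at `v`: an `Ā`-presentation
`πI : T/IT ↠ (T/IT)/Ī` composed with `π̄` is an `A`-presentation of `T/(ψ⁻¹Ī)T` (reading the carriers over `A`
through `ψ`), an injective `Quot(T/IT)`-morphism with scalar `r̄ = ψ(r)` is an injective `Quot(T)`-morphism with
scalar `r`, and propagating along `πI ∘ π̄` is propagating `π̄_* L` along `πI`.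
[cite: Howard2004HeegnerKolyvagin, §1.3 H.3 and Remark 1.3.1 (arXiv p. 7 L65–67, L125–127), Def. 1.1.2–1.1.3 (p. 5 L88–99)] -/
theorem isCartesianOnQuotAt_map_of_ringChange (ψ : A →+* Abar) (hψ : Surjective ψ)
    (ρ : DiscreteGaloisModule K M) (ρbar : DiscreteGaloisModule K Nbar) (πbar : M →+ Nbar)
    (hπe : ∀ (g : absoluteGaloisGroup K) (m : M), πbar (ρ g m) = ρbar g (πbar m))
    (hπs : Surjective πbar) (hπl : ∀ (a : A) (m : M), πbar (a • m) = ψ a • πbar m)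
    (hπk : ∀ m : M, πbar m = 0 ↔ m ∈ (RingHom.ker ψ • (⊤ : Submodule A M) : Submodule A M))
    (v : Place K) (L : AddSubgroup (galoisCohomology (ρ.toLocal v) 1)) (h3 : IsCartesianOnQuotAt ρ A v L) :
    IsCartesianOnQuotAt ρbar Abar v
      (L.map (ContinuousRep.cohomologyMap (ρ.toLocal v) (ρbar.toLocal v) πbar continuous_of_discreteTopology
        (fun _ m => hπe _ m) 1)) := by
  intro Ibar Jbar N N' _ _ _ _ _ _ _ _ ρI πI ρJ πJ hI hJ rbar f hf hinj
  -- read the carriers over `A` through `ψ`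
  letI : Module A N := Module.compHom N ψ
  letI : Module A N' := Module.compHom N' ψ
  obtain ⟨r, rfl⟩ := hψ rbar
  -- the composite presentations over `A`
  let qI : M →ₗ[A] N :=
    { toFun := fun m => πI (πbar m)
      map_add' := fun x y => by rw [map_add, map_add]
      map_smul' := fun a m => by
        rw [hπl, map_smul]
        rfl }
  let qJ : M →ₗ[A] N' :=
    { toFun := fun m => πJ (πbar m)
      map_add' := fun x y => by rw [map_add, map_add]
      map_smul' := fun a m => by
        rw [hπl, map_smul]
        rfl }
  have hqI : IsQuotientBy ρ (Ibar.comap ψ) ρI qI :=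
    { surjective := hI.surjective.comp hπs
      ker_eq := by
        ext m
        rw [LinearMap.mem_ker]
        exact comp_eq_zero_iff_of_ringChange ψ hψ πbar hπs hπl hπk Ibar πI hI.ker_eq m
      equivariant := fun g m => by
        change πI (πbar (ρ g m)) = ρI g (πI (πbar m))
        rw [hπe, hI.equivariant] }
  have hqJ : IsQuotientBy ρ (Jbar.comap ψ) ρJ qJ :=
    { surjective := hJ.surjective.comp hπs
      ker_eq := by
        ext m
        rw [LinearMap.mem_ker]
        exact comp_eq_zero_iff_of_ringChange ψ hψ πbar hπs hπl hπk Jbar πJ hJ.ker_eq m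
      equivariant := fun g m => by
        change πJ (πbar (ρ g m)) = ρJ g (πJ (πbar m))
        rw [hπe, hJ.equivariant] }
  -- the morphism, read over `A`
  let fA : N →ₗ[A] N' :=
    { toFun := f
      map_add' := fun x y => map_add f x y
      map_smul' := fun a x => by
        change f (ψ a • x) = ψ a • f x
        rw [map_smul] }
  have hfA : IsQuotMorphism ρ (Ibar.comap ψ) (Jbar.comap ψ) ρI qI ρJ qJ r fA :=
    { smul_le := fun x hx => by
        rw [Ideal.mem_comap, map_mul]
        exact hf.smul_le _ hx
      comp_eq := fun m => by
        change f (πI (πbar m)) = ψ r • πJ (πbar m)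
        exact hf.comp_eq (πbar m)
      equivariant := fun g x => hf.equivariant g x }
  have hinjA : Function.Injective fA := hinj
  have h := h3 (Ibar.comap ψ) (Jbar.comap ψ) N N' ρI qI ρJ qJ hqI hqJ r fA hfA hinjA
  -- propagating along `πI ∘ π̄` is propagating `π̄_* L` along `πI`
  have hPI : hqI.propagate v L = hI.propagate v (L.map (ContinuousRep.cohomologyMap (ρ.toLocal v)
      (ρbar.toLocal v) πbar continuous_of_discreteTopology (fun _ m => hπe _ m) 1)) := by
    rw [IsQuotientBy.propagate, IsQuotientBy.propagate, AddSubgroup.map_map]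
    congr 1
    exact AddMonoidHom.ext fun y =>
      hqI.localCohomologyMap_one_eq_comp_apply hI πbar hπe (fun _ => rfl) v y
  have hPJ : hqJ.propagate v L = hJ.propagate v (L.map (ContinuousRep.cohomologyMap (ρ.toLocal v)
      (ρbar.toLocal v) πbar continuous_of_discreteTopology (fun _ m => hπe _ m) 1)) := by
    rw [IsQuotientBy.propagate, IsQuotientBy.propagate, AddSubgroup.map_map]
    congr 1
    exact AddMonoidHom.ext fun y =>
      hqJ.localCohomologyMap_one_eq_comp_apply hJ πbar hπe (fun _ => rfl) v y
  rw [hPI, hPJ] at h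
  exact h

end Cartesian

/-! ## §3 H.3 for the π-adic refinement of a `DVRSetting` -/

namespace DVRSetting

variable {p : ℕ} [Fact p.Prime] {K : Type} [Field K] [NumberField K]
  {R : Type} [CommRing R] [IsDomain R] [IsDiscreteValuationRing R] [Algebra ℤ_[p] R]
  {N : ℕ → Type} [∀ k, AddCommGroup (N k)] [∀ k, TopologicalSpace (N k)]
  [∀ k, DiscreteTopology (N k)] [∀ k, Module R (N k)]
  {Rk : ℕ → Type} [∀ k, CommRing (Rk k)] [∀ k, IsLocalRing (Rk k)] [∀ k, TopologicalSpace (Rk k)]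
  [∀ k, DiscreteTopology (Rk k)] [∀ k, Algebra ℤ_[p] (Rk k)] [∀ k, Algebra R (Rk k)]
  [∀ k, Module (Rk k) (N k)] [∀ k, IsScalarTower R (Rk k) (N k)]
  {Nbar : Type} [AddCommGroup Nbar] [TopologicalSpace Nbar] [DiscreteTopology Nbar]
  [∀ k, Module (Rk k) Nbar]
  {Nq : ℕ → Finset (HeightOneSpectrum (𝓞 K)) → Type} [∀ k n, AddCommGroup (Nq k n)]
  [∀ k n, TopologicalSpace (Nq k n)] [∀ k n, DiscreteTopology (Nq k n)]
  [∀ k n, Module (Rk k) (Nq k n)] [∀ k n, Module R (Nq k n)]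
  [∀ k n, IsScalarTower R (Rk k) (Nq k n)]

/-- `j ≤ e_k` for any level `k` hosting the exponent `j`. [cite: Howard2004HeegnerKolyvagin, §1.6 (arXiv p. 11 L33–36)] -/
theorem le_e_of_host_le (S : DVRSetting p K R N Rk Nbar Nq) (hy : S.SatisfiesH) {j k : ℕ}
    (h : (S.piRefinementDatum hy).host j ≤ k) : j ≤ S.e k :=
  ((S.piRefinementDatum hy).le_e_host j).trans (hy.e_strictMono.monotone h)

/-- At its own host, `proj : T^{(k)} ↠ T/π^jT` (`k = host j`) IS the quotient map `N_k ↠ N_k ⧸ (π^j)·N_k`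
(`redLE (le_refl k) = id`). [cite: Howard2004HeegnerKolyvagin, §1.6 (arXiv p. 11 L33–36)] -/
theorem proj_self_eq_mkQ (S : DVRSetting p K R N Rk Nbar Nq) (hy : S.SatisfiesH) (j : ℕ) (y : N (S.host hy j)) :
    (S.piRefinementDatum hy).proj (le_refl (S.host hy j)) y =
      (Ideal.span {S.π ^ j} • (⊤ : Submodule R (N (S.host hy j)))).mkQ y := by
  rw [PiRefinementDatum.proj_apply, piRefinementDatum_red]
  exact congrArg _ (AdicTower.redLE_self S.T _ y)

/-- **The quotient map `N_k ↠ N_k ⧸ (π^j)·N_k` is `toQuotRing`-semilinear** (`j ≤ e_k`): `mk (a · y) = toQuotRing(a) · mk y`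
for `a ∈ R_k`, the `R/π^j`-module structure being Mathlib's `Module (R ⧸ I) (M ⧸ I • ⊤)`.
[cite: Howard2004HeegnerKolyvagin, §1.6 (arXiv p. 11 L33–36: `R^{(k)} = R/𝔪^k`, `T^{(k)} = T/𝔪^kT`)] -/
theorem mkQ_smul_levelRing (S : DVRSetting p K R N Rk Nbar Nq) (hy : S.SatisfiesH) {j k : ℕ} (h : j ≤ S.e k)
    (a : Rk k) (y : N k) :
    (Ideal.span {S.π ^ j} • (⊤ : Submodule R (N k))).mkQ (a • y) =
      S.toQuotRing hy h a • (Ideal.span {S.π ^ j} • (⊤ : Submodule R (N k))).mkQ y := by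
  obtain ⟨r, rfl⟩ := hy.algebraMap_surjective _ a
  rw [S.toQuotRing_algebraMap hy, algebraMap_smul, Submodule.mkQ_apply, Submodule.mkQ_apply]
  rfl

/-- `mk y = 0 ↔ y ∈ (ker toQuotRing)·T^{(k)}` in `N_k ⧸ (π^j)·N_k` (`ker toQuotRing = (π̄^j)`).
[cite: Howard2004HeegnerKolyvagin, §1.6 (arXiv p. 11 L33–36)] -/
theorem mkQ_eq_zero_iff_mem_ker_smul (S : DVRSetting p K R N Rk Nbar Nq) (hy : S.SatisfiesH) {j k : ℕ}
    (h : j ≤ S.e k) (y : N k) :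
    (Ideal.span {S.π ^ j} • (⊤ : Submodule R (N k))).mkQ y = 0 ↔
      y ∈ (RingHom.ker (S.toQuotRing hy h) • (⊤ : Submodule (Rk k) (N k)) : Submodule (Rk k) (N k)) := by
  rw [S.ker_toQuotRing hy, ← S.mem_span_pi_pow_smul_top_iff, Submodule.mkQ_apply, Submodule.Quotient.mk_eq_zero]

/-- **H.3 on `T^{(k)}/π^j T^{(k)}` for the propagated condition**, any `k` with `j ≤ e_k`, over the level ring `R/π^j`
acting on the LITERAL carrier `N_k ⧸ (π^j)·N_k` of `modIdeal (S.T.ρ k) _ (π^j)` (the currency in which Mathlib's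
`Module (R ⧸ I) (M ⧸ I • ⊤)` is found by instance search): the condition `F_k v` pushed along the quotient map is
cartesian on `Quot(T^{(k)}/π^j)` at every `v ∈ Σ(F)` — from H.3 at level `k` (`hy.h3`) by the base change of §2.
[cite: Howard2004HeegnerKolyvagin, §1.3 H.3 and Remark 1.3.1 (arXiv p. 7 L65–67, L125–127)] -/
theorem isCartesianOnQuotAt_map_mkQ (S : DVRSetting p K R N Rk Nbar Nq) (hy : S.SatisfiesH) {j k : ℕ}
    (h : j ≤ S.e k) {v : Place K} (hv : v ∈ S.Sigma) :
    IsCartesianOnQuotAt (modIdeal (S.T.ρ k) (S.T.hlin k) (Ideal.span {S.π ^ j})) (S.QuotRing j) v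
      (((S.t k).cond v).map ((isQuotientBy_modIdeal (S.T.ρ k) (S.T.hlin k)
        (Ideal.span {S.π ^ j})).localCohomologyMap v 1)) := by
  have hSig : v ∈ (S.t k).Sigma := by rw [hy.Sigma_eq]; exact hv
  exact isCartesianOnQuotAt_map_of_ringChange (S.toQuotRing hy h) (S.toQuotRing_surjective hy h) (S.T.ρ k)
    (modIdeal (S.T.ρ k) (S.T.hlin k) (Ideal.span {S.π ^ j}))
    (Ideal.span {S.π ^ j} • (⊤ : Submodule R (N k))).mkQ.toAddMonoidHom
    (fun g m => (isQuotientBy_modIdeal (S.T.ρ k) (S.T.hlin k) (Ideal.span {S.π ^ j})).equivariant g m)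
    (Submodule.mkQ_surjective _) (fun a y => S.mkQ_smul_levelRing hy h a y)
    (fun y => S.mkQ_eq_zero_iff_mem_ker_smul hy h y) v ((S.t k).cond v) (hy.h3 k v hSig)

/-- **H.3 for the refined triples** `(T/π^jT, F, 𝓛)` (x10b-p1-w2 g16's `refinedTriple` / `refinedCond` = `F_k` propagated
along `proj`, `k = host j`; the datum's `levelRep j` on `Level j` IS `modIdeal (S.T.ρ k) _ (π^j)` on `N_k ⧸ (π^j)·N_k` by
`rfl`, and `proj = mk` there) — the clause `SatisfiesH.h3` of the refined setting at EVERY exponent `j`.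
[cite: Howard2004HeegnerKolyvagin, §1.3 H.3 and Remark 1.3.1 (arXiv p. 7 L65–67, L125–127)] -/
theorem h3_refinedTriple (S : DVRSetting p K R N Rk Nbar Nq) (hy : S.SatisfiesH) (j : ℕ) :
    H3 (modIdeal (S.T.ρ (S.host hy j)) (S.T.hlin (S.host hy j)) (Ideal.span {S.π ^ j})) (S.QuotRing j)
      (S.refinedTriple hy j) := by
  intro v hv
  have key := S.isCartesianOnQuotAt_map_mkQ hy (S.le_e_host hy j) (v := v) hv
  have hL : (S.refinedTriple hy j).cond v = ((S.t (S.host hy j)).cond v).map ((isQuotientBy_modIdeal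
      (S.T.ρ (S.host hy j)) (S.T.hlin (S.host hy j)) (Ideal.span {S.π ^ j})).localCohomologyMap v 1) := by
    rw [refinedTriple_cond, S.refinedCond_apply_eq_map hy (le_refl ((S.piRefinementDatum hy).host j)) v]
    congr 1
    exact AddMonoidHom.ext fun x => cohomologyMap_one_congr_apply ((S.T.ρ (S.host hy j)).toLocal v)
      ((modIdeal (S.T.ρ (S.host hy j)) (S.T.hlin (S.host hy j)) (Ideal.span {S.π ^ j})).toLocal v)
      ((S.piRefinementDatum hy).proj (le_refl ((S.piRefinementDatum hy).host j))).toAddMonoidHom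
      (Ideal.span {S.π ^ j} • (⊤ : Submodule R (N (S.host hy j)))).mkQ.toAddMonoidHom
      (fun g m => ((S.piRefinementDatum hy).isQuotientBy_levelRep le_rfl).equivariant _ m)
      (fun g m => (isQuotientBy_modIdeal (S.T.ρ (S.host hy j)) (S.T.hlin (S.host hy j))
        (Ideal.span {S.π ^ j})).equivariant _ m)
      (fun y => S.proj_self_eq_mkQ hy j y) x
  rw [hL]
  exact key

end DVRSetting

end Literature.NumberTheory.GaloisCohomology.Howard2004

end
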